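import Mathlib.Analysis.SpecialFunctions.Pow.Real
import Mathlib.Analysis.SpecialFunctions.Sqrt

/-!
# K1loc, line `Spectral` / SeqCone — helper: SCALING OF THE CONCRETE HALF-SLOT ERRORS IN THE RADIUS SCALE `L₀`
# (S-B ↔ S-D hand-over glue, thin start)

Helper file of the prover lane on the crux `K1LocalisedCascade` (stmt-AnomalousDissipation-19491), route
`SawtoothPulseCascade` (glue seat k1loc-p3).  The explicit per-slot amplitude and energy errors of
`…K1Ledger.cascade_ledger_step_H/V_concrete` along a schedule `L_j = L₀ρ^j` (fibre scale `b_j = L₀ρ^j/(20γ_b(1+1/250))`,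
envelope `Rw`) are majorised by `…LedgerMajorantsSum.exists_errX_bound / exists_errY_bound` with an EXISTENTIAL constant that
depends on `L₀`.  For the thin start (schedule «from phase i₀», `…LedgerScheduleFrom`) the scale `L₀ ≤ 1` varies with the
hand-over phase, so the `L₀`-dependence must be explicit.  It is a pure scaling: every term of the two error expressions is
either proportional to `1/b_j ∝ 1/L₀`, or to `1/√b_j`, or `L₀`-free, and the envelope enters increasingly; hence for
`0 < L₀ ≤ 1` and `Rw ≤ Rw₁`:  **`X(L₀, Rw) ≤ X(1, Rw₁)/L₀`** (`errX_scale`) and **`Y(L₀) ≤ Y(1)/L₀`** (`errY_scale`), stated on the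
LITERAL expressions of `exists_errX_bound` / `exists_errY_bound` (so that the majorants are invoked once, at `L₀ = 1`).
Pure real algebra; no definitions. [cite: ElgindiLissMattingly2025, §1.2.1] [problem: turb]
-/

-- `Summit.<Summit>.<Problem>`: single-conjunct summit, the duplicate namespace segment is deliberate.
set_option linter.dupNamespace false

noncomputable section

namespace Summit.AnomalousDissipation.AnomalousDissipation.Theorems.SawtoothPulseCascade.K1Ledger.From

open Real

/-- `√(x/L) ≤ √x / L` for `0 < L ≤ 1`. [folklore] -/
theorem sqrt_div_le_sqrt_div (x : ℝ) {L : ℝ} (hL : 0 < L) (hL1 : L ≤ 1) :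
    Real.sqrt (x / L) ≤ Real.sqrt x / L := by
  rw [Real.sqrt_div' x hL.le]
  have hsL : L ≤ Real.sqrt L := by
    have h := Real.sqrt_le_sqrt (by nlinarith : L ^ 2 ≤ L)
    rwa [Real.sqrt_sq hL.le] at h
  exact div_le_div_of_nonneg_left (Real.sqrt_nonneg x) hL hsL

set_option maxHeartbeats 400000 in
/-- **Scaling of the amplitude error** (literal left-hand side of `…exists_errX_bound`): for `0 < L ≤ 1` and envelope radii
`0 ≤ Rw ≤ Rw₁`, `X(L, Rw) ≤ X(1, Rw₁)/L`. [cite: ElgindiLissMattingly2025, §1.2.1] -/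
theorem errX_scale {γ γb L ρ δ₀ C₁ Co Cn κ M tH c₁ c₂ Rw Rw₁ : ℝ} {j : ℕ}
    (hL : 0 < L) (hL1 : L ≤ 1) (hγ : 0 ≤ γ) (hγb : 0 < γb) (hρ : 0 < ρ) (hδ₀ : 0 < δ₀) (hC₁ : 0 ≤ C₁) (hCo : 0 ≤ Co)
    (hCn : 0 ≤ Cn) (hκ : 0 ≤ κ) (hM : 0 ≤ M) (htH : 0 ≤ tH) (hc₁ : 0 ≤ c₁) (hc₂ : 0 ≤ c₂) (hRw : 0 ≤ Rw)
    (hRw1 : Rw ≤ Rw₁) :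
    Real.sqrt 2 * (Co / (L * ρ ^ j / (20 * γb * (1 + 1 / 250))) * (c₂ / (4 * Real.pi * Real.sqrt 3))) +
        Real.sqrt 2 * (2 * κ * tH * c₂ + 4 * c₁ * Real.sqrt (κ * tH / 2) +
            Real.sqrt (γ * (2 * (2 * (1 / (1000 * ((1 + γ) ^ 2 + 1) ^ j)))) * (5 + 6 * c₁ ^ 2 * κ * tH)) +
            Co / (L * ρ ^ j / (20 * γb * (1 + 1 / 250))) *
              ((c₂ + 2 * Real.pi * c₁ + Real.pi ^ 2) / (2 * Real.sqrt 3 * (2 * Real.pi))) +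
            Co / (L * ρ ^ j / (20 * γb * (1 + 1 / 250))) * ((2 * Real.pi * Rw *
                (γ * ((2 + 8 * C₁) * (M + 4) * (2 * Real.pi / δ₀ * 4 ^ j) *
                  (3 * (1 / (1000 * ((1 + γ) ^ 2 + 1) ^ j))))) +
              (2 * Real.pi * Rw * (γ * (2 * (3 * (1 / (1000 * ((1 + γ) ^ 2 + 1) ^ j)))))) ^ 2) /
                (4 * Real.pi * Real.sqrt 3)) +
          Real.sqrt (2 * (Cn / (L * ρ ^ j / (20 * γb * (1 + 1 / 250))) *
            ((c₂ + 2 * Real.pi * c₁ + Real.pi ^ 2) / (2 * Real.sqrt 3 * (2 * Real.pi)))))) ≤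
      1 / L * (Real.sqrt 2 * (Co / (1 * ρ ^ j / (20 * γb * (1 + 1 / 250))) * (c₂ / (4 * Real.pi * Real.sqrt 3))) +
        Real.sqrt 2 * (2 * κ * tH * c₂ + 4 * c₁ * Real.sqrt (κ * tH / 2) +
            Real.sqrt (γ * (2 * (2 * (1 / (1000 * ((1 + γ) ^ 2 + 1) ^ j)))) * (5 + 6 * c₁ ^ 2 * κ * tH)) +
            Co / (1 * ρ ^ j / (20 * γb * (1 + 1 / 250))) *
              ((c₂ + 2 * Real.pi * c₁ + Real.pi ^ 2) / (2 * Real.sqrt 3 * (2 * Real.pi))) +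
            Co / (1 * ρ ^ j / (20 * γb * (1 + 1 / 250))) * ((2 * Real.pi * Rw₁ *
                (γ * ((2 + 8 * C₁) * (M + 4) * (2 * Real.pi / δ₀ * 4 ^ j) *
                  (3 * (1 / (1000 * ((1 + γ) ^ 2 + 1) ^ j))))) +
              (2 * Real.pi * Rw₁ * (γ * (2 * (3 * (1 / (1000 * ((1 + γ) ^ 2 + 1) ^ j)))))) ^ 2) /
                (4 * Real.pi * Real.sqrt 3)) +
          Real.sqrt (2 * (Cn / (1 * ρ ^ j / (20 * γb * (1 + 1 / 250))) *
            ((c₂ + 2 * Real.pi * c₁ + Real.pi ^ 2) / (2 * Real.sqrt 3 * (2 * Real.pi))))))) := by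
  -- names for the `L`-free pieces
  set b₁ : ℝ := 1 * ρ ^ j / (20 * γb * (1 + 1 / 250)) with hb₁
  set P1 : ℝ := c₂ / (4 * Real.pi * Real.sqrt 3) with hP1
  set TA : ℝ := 2 * κ * tH * c₂ + 4 * c₁ * Real.sqrt (κ * tH / 2) +
    Real.sqrt (γ * (2 * (2 * (1 / (1000 * ((1 + γ) ^ 2 + 1) ^ j)))) * (5 + 6 * c₁ ^ 2 * κ * tH)) with hTA
  set X5 : ℝ := (c₂ + 2 * Real.pi * c₁ + Real.pi ^ 2) / (2 * Real.sqrt 3 * (2 * Real.pi)) with hX5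
  set a : ℝ := γ * ((2 + 8 * C₁) * (M + 4) * (2 * Real.pi / δ₀ * 4 ^ j) *
    (3 * (1 / (1000 * ((1 + γ) ^ 2 + 1) ^ j)))) with ha
  set q : ℝ := γ * (2 * (3 * (1 / (1000 * ((1 + γ) ^ 2 + 1) ^ j)))) with hq
  set D : ℝ := 4 * Real.pi * Real.sqrt 3 with hD
  have hb₁0 : 0 < b₁ := by rw [hb₁]; positivity
  have hP10 : 0 ≤ P1 := by rw [hP1]; positivity
  have hTA0 : 0 ≤ TA := by rw [hTA]; positivity
  have hX50 : 0 ≤ X5 := by rw [hX5]; positivity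
  have ha0 : 0 ≤ a := by rw [ha]; positivity
  have hq0 : 0 ≤ q := by rw [hq]; positivity
  have hD0 : 0 < D := by rw [hD]; positivity
  have hRw10 : 0 ≤ Rw₁ := hRw.trans hRw1
  -- the fibre scale at `L` is `L·b₁`
  have hbL : L * ρ ^ j / (20 * γb * (1 + 1 / 250)) = L * b₁ := by rw [hb₁]; ring
  rw [hbL]
  have h1L : 1 ≤ 1 / L := by rw [le_div_iff₀ hL]; linarith
  have hL0' : 0 < 1 / L := by positivity
  have hCoL : Co / (L * b₁) = 1 / L * (Co / b₁) := by field_simp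
  have hCnL : Cn / (L * b₁) = 1 / L * (Cn / b₁) := by field_simp
  rw [hCoL, hCnL]
  have hCob : 0 ≤ Co / b₁ := div_nonneg hCo hb₁0.le
  have hCnb : 0 ≤ Cn / b₁ := div_nonneg hCn hb₁0.le
  -- termwise comparisons
  have hTA' : TA ≤ 1 / L * TA := le_mul_of_one_le_left hTA0 h1L
  have htw : (2 * Real.pi * Rw * a + (2 * Real.pi * Rw * q) ^ 2) / D ≤
      (2 * Real.pi * Rw₁ * a + (2 * Real.pi * Rw₁ * q) ^ 2) / D := by
    gcongr
  have htw0 : 0 ≤ (2 * Real.pi * Rw₁ * a + (2 * Real.pi * Rw₁ * q) ^ 2) / D := by positivity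
  have hsq : Real.sqrt (2 * (1 / L * (Cn / b₁) * X5)) ≤ 1 / L * Real.sqrt (2 * (Cn / b₁ * X5)) := by
    have e : 2 * (1 / L * (Cn / b₁) * X5) = (2 * (Cn / b₁ * X5)) / L := by ring
    rw [e]
    calc Real.sqrt (2 * (Cn / b₁ * X5) / L) ≤ Real.sqrt (2 * (Cn / b₁ * X5)) / L :=
          sqrt_div_le_sqrt_div _ hL hL1
      _ = 1 / L * Real.sqrt (2 * (Cn / b₁ * X5)) := by ring
  have hs2 : 0 ≤ Real.sqrt 2 := Real.sqrt_nonneg _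
  -- assemble
  have hinner : TA + 1 / L * (Co / b₁) * X5 + 1 / L * (Co / b₁) * ((2 * Real.pi * Rw * a + (2 * Real.pi * Rw * q) ^ 2) / D) +
      Real.sqrt (2 * (1 / L * (Cn / b₁) * X5)) ≤
      1 / L * (TA + Co / b₁ * X5 + Co / b₁ * ((2 * Real.pi * Rw₁ * a + (2 * Real.pi * Rw₁ * q) ^ 2) / D) +
        Real.sqrt (2 * (Cn / b₁ * X5))) := by
    have h3 : 1 / L * (Co / b₁) * ((2 * Real.pi * Rw * a + (2 * Real.pi * Rw * q) ^ 2) / D) ≤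
        1 / L * (Co / b₁) * ((2 * Real.pi * Rw₁ * a + (2 * Real.pi * Rw₁ * q) ^ 2) / D) :=
      mul_le_mul_of_nonneg_left htw (by positivity)
    nlinarith [hTA', h3, hsq]
  calc Real.sqrt 2 * (1 / L * (Co / b₁) * P1) +
        Real.sqrt 2 * (TA + 1 / L * (Co / b₁) * X5 +
          1 / L * (Co / b₁) * ((2 * Real.pi * Rw * a + (2 * Real.pi * Rw * q) ^ 2) / D) +
          Real.sqrt (2 * (1 / L * (Cn / b₁) * X5)))
      ≤ Real.sqrt 2 * (1 / L * (Co / b₁) * P1) +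
        Real.sqrt 2 * (1 / L * (TA + Co / b₁ * X5 + Co / b₁ * ((2 * Real.pi * Rw₁ * a + (2 * Real.pi * Rw₁ * q) ^ 2) / D) +
          Real.sqrt (2 * (Cn / b₁ * X5)))) := by
        gcongr
    _ = 1 / L * (Real.sqrt 2 * (Co / b₁ * P1) +
        Real.sqrt 2 * (TA + Co / b₁ * X5 + Co / b₁ * ((2 * Real.pi * Rw₁ * a + (2 * Real.pi * Rw₁ * q) ^ 2) / D) +
          Real.sqrt (2 * (Cn / b₁ * X5)))) := by ring

/-- **Scaling of the energy error** (literal left-hand side of `…exists_errY_bound`): for `0 < L ≤ 1`, `Y(L) ≤ Y(1)/L`.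
[cite: ElgindiLissMattingly2025, §1.2.1] -/
theorem errY_scale {γb L ρ δ₀ Cn M c₂ E₀ B : ℝ} {j : ℕ}
    (hL : 0 < L) (hL1 : L ≤ 1) (hγb : 0 < γb) (hρ : 0 < ρ) (hδ₀ : 0 < δ₀) (hCn : 0 ≤ Cn) (hM : 0 ≤ M) (hc₂ : 0 ≤ c₂)
    (hB : 0 ≤ B) :
    2 * (Cn / (L * ρ ^ j / (20 * γb * (1 + 1 / 250))) * (c₂ / (4 * Real.pi * Real.sqrt 3)) * E₀) +
        (B ^ 2 * (4 * M * (δ₀ / 2 ^ j) / Real.pi) +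
          2 * (Cn / (L * ρ ^ j / (20 * γb * (1 + 1 / 250))) * ((c₂ + c₂) / (4 * Real.pi * Real.sqrt 3)) * E₀ +
            Real.sqrt E₀ * ((B / 4) * Real.sqrt (4 * M * (δ₀ / 2 ^ j) / Real.pi)))) ≤
      1 / L * (2 * (Cn / (1 * ρ ^ j / (20 * γb * (1 + 1 / 250))) * (c₂ / (4 * Real.pi * Real.sqrt 3)) * E₀) +
        (B ^ 2 * (4 * M * (δ₀ / 2 ^ j) / Real.pi) +
          2 * (Cn / (1 * ρ ^ j / (20 * γb * (1 + 1 / 250))) * ((c₂ + c₂) / (4 * Real.pi * Real.sqrt 3)) * E₀ +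
            Real.sqrt E₀ * ((B / 4) * Real.sqrt (4 * M * (δ₀ / 2 ^ j) / Real.pi))))) := by
  set b₁ : ℝ := 1 * ρ ^ j / (20 * γb * (1 + 1 / 250)) with hb₁
  set Z1 : ℝ := B ^ 2 * (4 * M * (δ₀ / 2 ^ j) / Real.pi) with hZ1
  set Z2 : ℝ := Real.sqrt E₀ * ((B / 4) * Real.sqrt (4 * M * (δ₀ / 2 ^ j) / Real.pi)) with hZ2
  set X : ℝ := c₂ / (4 * Real.pi * Real.sqrt 3) with hX
  set X2 : ℝ := (c₂ + c₂) / (4 * Real.pi * Real.sqrt 3) with hX2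
  have hb₁0 : 0 < b₁ := by rw [hb₁]; positivity
  have hZ10 : 0 ≤ Z1 := by rw [hZ1]; positivity
  have hZ20 : 0 ≤ Z2 := by rw [hZ2]; positivity
  have hX0 : 0 ≤ X := by rw [hX]; positivity
  have hX20 : 0 ≤ X2 := by rw [hX2]; positivity
  have hbL : L * ρ ^ j / (20 * γb * (1 + 1 / 250)) = L * b₁ := by rw [hb₁]; ring
  rw [hbL]
  have h1L : 1 ≤ 1 / L := by rw [le_div_iff₀ hL]; linarith
  have hCnL : Cn / (L * b₁) = 1 / L * (Cn / b₁) := by field_simp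
  rw [hCnL]
  have hCnb : 0 ≤ Cn / b₁ := div_nonneg hCn hb₁0.le
  have hZ1' : Z1 ≤ 1 / L * Z1 := le_mul_of_one_le_left hZ10 h1L
  have hZ2' : Z2 ≤ 1 / L * Z2 := le_mul_of_one_le_left hZ20 h1L
  have e : 1 / L * (2 * (Cn / b₁ * X * E₀) + (Z1 + 2 * (Cn / b₁ * X2 * E₀ + Z2))) =
      2 * (1 / L * (Cn / b₁) * X * E₀) + (1 / L * Z1 + 2 * (1 / L * (Cn / b₁) * X2 * E₀ + 1 / L * Z2)) := by ring
  rw [e]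
  gcongr

end Summit.AnomalousDissipation.AnomalousDissipation.Theorems.SawtoothPulseCascade.K1Ledger.From
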